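import Literature.Barriers.CriticalPhenomena.WeaklySAWFourDimLogCorrectionsCesaro
import Literature.Barriers.CriticalPhenomena.WeaklySAWFourDimLogCorrectionsLemma21
import Literature.Analysis.Asymptotics.KaramataTauberianLaplace
import Literature.Analysis.Asymptotics.SlowlyVaryingIntegral
import HarnessLib

/-!
# BBS 2015, §1.3: the Cesàro asymptotics of `c_T` from Theorem 1.1 by Karamata's Tauberian theorem

Companion (theorems only) to `WeaklySAWFourDimLogCorrectionsCesaro.lean`, which vendors the
sign-corrected reading `CTWSAW.BBS2015_cesaro_corrected` of the first display of §1.3 of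
R. Bauerschmidt, D. C. Brydges, G. Slade, *Logarithmic correction for the susceptibility of the
4-dimensional weakly self-avoiding walk: a renormalisation group analysis*, CMP 337 (2015),
arXiv:1403.7422: "For `d = 4`, Theorem 1.1 and a standard Tauberian theorem [Fell71] imply that
`T⁻¹∫₀ᵀ c_S e^{-ν_c S} dS ∼ A_g (log T)^{1/4}`" (sign of `ν_c` as forced by (1.3); the display as
printed, `CTWSAW.BBS2015_cesaro`, is refuted in `WeaklySAWFourDimLogCorrectionsDecay.lean`).

## What is proved

* `CTWSAW.tendsto_cesaro_of_tendsto_susceptibility` — the Tauberian step for one `g`: if `A > 0`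
  and `χ(g, ν_c + ε)/(A ε⁻¹(log ε⁻¹)^{1/4}) → 1` as `ε ↓ 0` (conclusion (1.9) of Theorem 1.1), then
  `∫₀ᵀ c_S e^{-ν_c S} dS / (T · A (log T)^{1/4}) → 1`. Ingredients: by (1.3),
  `χ(g, ν_c + ε) = ∫₀^∞ (c_T e^{-ν_c T}) e^{-εT} dT` is the Laplace transform of
  `u(t) = c_t e^{-ν_c t} ≥ 0` (`CTWSAW.integral_survival_toReal`, using the measurability of
  `T ↦ c_T` from `WeaklySAWFourDimLogCorrectionsLemma21.lean` and the finiteness of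
  `χ(g, ν_c + ε)` for `ε > 0`, which the hypothesis itself forces,
  `CTWSAW.susceptibility_lt_top_of_tendsto`); Karamata's Tauberian theorem for Laplace transforms
  with the slowly varying factor `(log ·)^{1/4}`
  (`Literature.Analysis.Asymptotics.karamata_tauberian_laplace`, Feller XIII.5 Theorem 2, `ρ = 1`);
  and the conversion back to the `ℝ≥0∞`-valued integral of the named fact.
* `CTWSAW.BBS2015_cesaro_corrected_of_thm11 : BBS2015_thm11 → BBS2015_cesaro_corrected` (same
  `g₀`, same constant `A = A_g`), and the same from the catalogued barrier statement
  `WeaklySAWFourDimLogCorrections` (`CTWSAW.BBS2015_cesaro_corrected_of_barrier`).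
* `CTWSAW.BBS2015_cesaro_corrected_of_pointwise :
  BBS2015_pointwise_prediction_corrected → BBS2015_cesaro_corrected` — consistency of the two
  corrected readings (the believed pointwise form is a strengthening of the proved Cesàro form), by
  the elementary Abelian estimate `∫₀ᵀ f ∼ A T L(T)` for `f ∼ A L`, `L = (log ·)^{1/4}`
  non-decreasing (`Literature.Analysis.Asymptotics.tendsto_setIntegral_div_of_tendsto_div`,
  `SlowlyVaryingIntegral.lean`) and `c_T ≤ 1`.

`BBS2015_cesaro_corrected` itself stays a named fact: its only missing input is Theorem 1.1
(`BBS2015_thm11`, the renormalisation-group theorem, reduced to Theorem 4.1 in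
`WeaklySAWFourDimLogCorrectionsReduction.lean`).

## References

* Bauerschmidt–Brydges–Slade 2015, §1.1 (1.3)–(1.4), Theorem 1.1, §1.3.
  [cite: BauerschmidtBrydgesSlade2015LogCorr]
* W. Feller, *An Introduction to Probability Theory and Its Applications* II, 2nd ed. 1971,
  XIII.5 Theorem 2. [cite: Feller1971]
-/

noncomputable section

open MeasureTheory Filter Topology Set
open scoped ENNReal

namespace Literature.Barriers.CriticalPhenomena

namespace CTWSAW

open Literature.Analysis.Asymptotics Literature.Probability.LatticeModels

variable {d : ℕ}

/-! ### The susceptibility above the critical value -/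

/-- From Theorem 1.1's asymptotics (any `A`): `χ(g, ν_c + ε) < ∞` for every `ε > 0` (the
Tendsto statement forces `χ(g, ν_c + ε).toReal ≠ 0`, hence `χ < ∞`, for small `ε`, and `χ` is
non-increasing in `ν`). [cite: BauerschmidtBrydgesSlade2015LogCorr, Theorem 1.1 and (1.4)] -/
theorem susceptibility_lt_top_of_tendsto {g A : ℝ}
    (h : Tendsto (fun ε : ℝ =>
        (susceptibility 4 g (criticalNu 4 g + ε)).toReal / (A * ε⁻¹ * Real.log ε⁻¹ ^ (1 / 4 : ℝ)))
      (𝓝[>] 0) (𝓝 1))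
    {ε : ℝ} (hε : 0 < ε) : susceptibility 4 g (criticalNu 4 g + ε) < ∞ := by
  have hev : ∀ᶠ δ : ℝ in 𝓝[>] 0, susceptibility 4 g (criticalNu 4 g + δ) < ∞ := by
    have h1 : ∀ᶠ δ : ℝ in 𝓝[>] 0, (1 / 2 : ℝ) <
        (susceptibility 4 g (criticalNu 4 g + δ)).toReal / (A * δ⁻¹ * Real.log δ⁻¹ ^ (1 / 4 : ℝ)) :=
      h.eventually (lt_mem_nhds (by norm_num))
    filter_upwards [h1] with δ hδ
    by_contra htop
    rw [not_lt, top_le_iff] at htop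
    rw [htop, ENNReal.toReal_top, zero_div] at hδ
    norm_num at hδ
  rw [eventually_nhdsWithin_iff, Metric.eventually_nhds_iff] at hev
  obtain ⟨ε₁, hε₁, hε₁'⟩ := hev
  set δ := min ε (ε₁ / 2) with hδ
  have hδ0 : 0 < δ := lt_min hε (by positivity)
  have hδ1 : δ < ε₁ := (min_le_right _ _).trans_lt (by linarith)
  have hfin : susceptibility 4 g (criticalNu 4 g + δ) < ∞ := by
    refine hε₁' (y := δ) ?_ hδ0
    rw [Real.dist_eq, sub_zero, abs_of_pos hδ0]
    exact hδ1
  exact (susceptibility_antitone 4 g (by linarith [min_le_left ε (ε₁ / 2)])).trans_lt hfin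

/-! ### The Laplace transform of `c_T e^{-ν_c T}` and the Tauberian step -/

/-- The integrand of `χ(g,ν)` in real form: `(c_T e^{-νT}).toReal = c_T.toReal e^{-ν_c T} e^{-(ν-ν_c)T}`.
[folklore] -/
theorem toReal_survival_mul (g ν T : ℝ) :
    (survival 4 g T * ENNReal.ofReal (Real.exp (-ν * T))).toReal =
      (survival 4 g T).toReal * Real.exp (-(criticalNu 4 g * T)) *
        Real.exp (-((ν - criticalNu 4 g) * T)) := by
  rw [ENNReal.toReal_mul, ENNReal.toReal_ofReal (Real.exp_pos _).le, mul_assoc, ← Real.exp_add]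
  congr 2
  ring

/-- For `ν` with `χ(g,ν) < ∞`: `t ↦ c_t.toReal e^{-ν_c t} e^{-(ν-ν_c)t}` is integrable on `(0,∞)`
with integral `χ(g,ν).toReal`. [cite: BauerschmidtBrydgesSlade2015LogCorr, §1.1 (1.3)] -/
theorem integral_survival_toReal {g ν : ℝ} (hfin : susceptibility 4 g ν < ∞) :
    IntegrableOn (fun t => (survival 4 g t).toReal * Real.exp (-(criticalNu 4 g * t)) *
        Real.exp (-((ν - criticalNu 4 g) * t))) (Set.Ioi 0) ∧
      ∫ t in Set.Ioi (0 : ℝ), (survival 4 g t).toReal * Real.exp (-(criticalNu 4 g * t)) *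
          Real.exp (-((ν - criticalNu 4 g) * t)) = (susceptibility 4 g ν).toReal := by
  have hmeas : AEMeasurable (fun T => survival 4 g T * ENNReal.ofReal (Real.exp (-ν * T)))
      (volume.restrict (Set.Ioi (0 : ℝ))) :=
    ((measurable_survival 4 g).mul
      ((measurable_const.mul measurable_id).exp.ennreal_ofReal)).aemeasurable
  have hne : ∫⁻ T in Set.Ioi (0 : ℝ), survival 4 g T * ENNReal.ofReal (Real.exp (-ν * T)) ≠ ∞ :=
    hfin.ne
  refine ⟨?_, ?_⟩
  · have := integrable_toReal_of_lintegral_ne_top hmeas hne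
    refine this.congr (ae_of_all _ fun t => ?_)
    exact toReal_survival_mul g ν t
  · have h2 := integral_toReal hmeas (ae_lt_top' hmeas hne)
    unfold susceptibility
    rw [← h2]
    refine integral_congr_ae (ae_of_all _ fun t => ?_)
    exact (toReal_survival_mul g ν t).symm

/-- `c_t < ∞` for a.e. `t > 0`, as soon as some `χ(g,ν)` is finite. [folklore] -/
theorem ae_survival_lt_top {g ν : ℝ} (hfin : susceptibility 4 g ν < ∞) :
    ∀ᵐ t ∂(volume.restrict (Set.Ioi (0 : ℝ))), survival 4 g t < ∞ := by
  have hmeas : AEMeasurable (fun T => survival 4 g T * ENNReal.ofReal (Real.exp (-ν * T)))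
      (volume.restrict (Set.Ioi (0 : ℝ))) :=
    ((measurable_survival 4 g).mul
      ((measurable_const.mul measurable_id).exp.ennreal_ofReal)).aemeasurable
  filter_upwards [ae_lt_top' hmeas hfin.ne] with t ht
  by_contra htop
  rw [not_lt, top_le_iff] at htop
  rw [htop, ENNReal.top_mul (by simp [Real.exp_pos])] at ht
  exact lt_irrefl _ ht

/-- **The Tauberian step of BBS 2015, §1.3**, for one value of `g`: if `A > 0` and
`χ(g, ν_c + ε) / (A ε⁻¹ (log ε⁻¹)^{1/4}) → 1` as `ε ↓ 0` (the conclusion (1.9) of Theorem 1.1),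
then `∫₀ᵀ c_S e^{-ν_c S} dS / (T · A (log T)^{1/4}) → 1` as `T → ∞`. Proof: Karamata's Tauberian
theorem `Literature.Analysis.Asymptotics.karamata_tauberian_laplace` (Feller XIII.5 Thm 2, `ρ = 1`)
applied to `u(t) = c_t e^{-ν_c t} ≥ 0`, whose Laplace transform at `ε` is `χ(g, ν_c + ε)` by (1.3),
with the slowly varying factor `L = (log ·)^{1/4}`.
[cite: BauerschmidtBrydgesSlade2015LogCorr, §1.3 (Cesàro average of c_T, "Theorem 1.1 and a standard Tauberian theorem [Fell71]")] -/
theorem tendsto_cesaro_of_tendsto_susceptibility {g A : ℝ} (hA : 0 < A)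
    (h : Tendsto (fun ε : ℝ =>
        (susceptibility 4 g (criticalNu 4 g + ε)).toReal / (A * ε⁻¹ * Real.log ε⁻¹ ^ (1 / 4 : ℝ)))
      (𝓝[>] 0) (𝓝 1)) :
    Tendsto (fun T : ℝ =>
        (∫⁻ S in Set.Ioc 0 T,
            survival 4 g S * ENNReal.ofReal (Real.exp (-criticalNu 4 g * S))).toReal /
          (T * (A * Real.log T ^ (1 / 4 : ℝ))))
      atTop (𝓝 1) := by
  set νc := criticalNu 4 g with hνc
  set u : ℝ → ℝ := fun t => (survival 4 g t).toReal * Real.exp (-(νc * t)) with hu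
  set L : ℝ → ℝ := fun x => Real.log x ^ (1 / 4 : ℝ) with hL
  have hfin : ∀ ε : ℝ, 0 < ε → susceptibility 4 g (νc + ε) < ∞ := fun ε hε =>
    susceptibility_lt_top_of_tendsto h hε
  -- the hypotheses of the Tauberian theorem
  have hu0 : ∀ t, 0 < t → 0 ≤ u t := fun t _ =>
    mul_nonneg ENNReal.toReal_nonneg (Real.exp_pos _).le
  have hint : ∀ δ : ℝ, 0 < δ →
      IntegrableOn (fun t => u t * Real.exp (-(δ * t))) (Set.Ioi 0) := by
    intro δ hδ
    have := (integral_survival_toReal (hfin δ hδ)).1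
    refine this.congr (ae_of_all _ fun t => ?_)
    simp only [hu]
    rw [← hνc, add_sub_cancel_left]
  have hlap : ∀ δ : ℝ, 0 < δ → ∫ t in Set.Ioi (0 : ℝ), u t * Real.exp (-(δ * t)) =
      (susceptibility 4 g (νc + δ)).toReal := by
    intro δ hδ
    rw [← (integral_survival_toReal (hfin δ hδ)).2]
    refine integral_congr_ae (ae_of_all _ fun t => ?_)
    simp only [hu]
    rw [← hνc, add_sub_cancel_left]
  have hLsv : IsSlowlyVarying L := isSlowlyVarying_log_rpow _
  have hLpos : ∀ᶠ x in atTop, 0 < L x := by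
    filter_upwards [eventually_gt_atTop 1] with x hx
    exact Real.rpow_pos_of_pos (Real.log_pos hx) _
  have hω : Tendsto (fun δ : ℝ => δ * (∫ t in Set.Ioi (0 : ℝ), u t * Real.exp (-(δ * t))) / L δ⁻¹)
      (𝓝[>] 0) (𝓝 A) := by
    have h2 := h.const_mul A
    rw [mul_one] at h2
    refine h2.congr' ?_
    have hev : ∀ᶠ δ : ℝ in 𝓝[>] 0, δ ∈ Set.Ioo (0 : ℝ) 1 :=
      Ioo_mem_nhdsGT one_pos
    filter_upwards [hev] with δ hδ
    rw [hlap δ hδ.1]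
    have hδ0 : δ ≠ 0 := hδ.1.ne'
    have hlog : 0 < Real.log δ⁻¹ := Real.log_pos (one_lt_inv₀ hδ.1 |>.mpr hδ.2)
    have hL0 : L δ⁻¹ ≠ 0 := (Real.rpow_pos_of_pos hlog _).ne'
    simp only [hL] at hL0 ⊢
    field_simp
  -- Karamata
  have hK := karamata_tauberian_laplace hu0 hint hLsv hLpos hω
  -- back to the `ℝ≥0∞` integral of the statement
  have hconv : ∀ T : ℝ, ∫ t in Set.Ioc 0 T, u t =
      (∫⁻ S in Set.Ioc 0 T, survival 4 g S * ENNReal.ofReal (Real.exp (-νc * S))).toReal := by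
    intro T
    have hmeas : AEMeasurable (fun S => survival 4 g S * ENNReal.ofReal (Real.exp (-νc * S)))
        (volume.restrict (Set.Ioc 0 T)) :=
      ((measurable_survival 4 g).mul
        ((measurable_const.mul measurable_id).exp.ennreal_ofReal)).aemeasurable
    have hae : ∀ᵐ S ∂(volume.restrict (Set.Ioc 0 T)),
        survival 4 g S * ENNReal.ofReal (Real.exp (-νc * S)) < ∞ := by
      have := ae_restrict_of_ae_restrict_of_subset
        (Set.Ioc_subset_Ioi_self : Set.Ioc (0 : ℝ) T ⊆ Set.Ioi 0)
        (ae_survival_lt_top (hfin 1 one_pos))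
      filter_upwards [this] with S hS
      exact ENNReal.mul_lt_top hS ENNReal.ofReal_lt_top
    rw [← integral_toReal hmeas hae]
    refine integral_congr_ae (ae_of_all _ fun t => ?_)
    simp only [hu, ENNReal.toReal_mul, ENNReal.toReal_ofReal (Real.exp_pos _).le, neg_mul]
  have h3 := hK.div_const A
  rw [div_self hA.ne'] at h3
  refine h3.congr' ?_
  filter_upwards [eventually_gt_atTop 0] with T hT
  rw [hconv T]
  simp only [hL]
  rw [div_div]
  congr 1
  ring

/-- **`BBS2015_thm11 → BBS2015_cesaro_corrected`**: the printed sentence "For `d = 4`, Theorem 1.1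
and a standard Tauberian theorem [Fell71] imply [the Cesàro asymptotics]" with the sign of `ν_c`
as forced by (1.3), made precise: Theorem 1.1 (`BBS2015_thm11`) and Karamata's Tauberian theorem
(Feller XIII.5, Theorem 2, `ρ = 1`, proved in `Literature.Analysis.Asymptotics`) give
`BBS2015_cesaro_corrected`, with the same `g₀` and the same constant `A = A_g`.
[cite: BauerschmidtBrydgesSlade2015LogCorr, §1.3 (Cesàro average of c_T) with Theorem 1.1] -/
theorem BBS2015_cesaro_corrected_of_thm11 (h : BBS2015_thm11) : BBS2015_cesaro_corrected := by
  obtain ⟨g₀, K, hg₀, hg⟩ := h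
  refine ⟨g₀, hg₀, fun g hg0 hgg => ?_⟩
  obtain ⟨A, hA, -, hT⟩ := hg g hg0 hgg
  exact ⟨A, hA, tendsto_cesaro_of_tendsto_susceptibility hA hT⟩

/-- The same, starting from the catalogued barrier statement
`Literature.Barriers.CriticalPhenomena.WeaklySAWFourDimLogCorrections` (which is `BBS2015_thm11`).
[cite: BauerschmidtBrydgesSlade2015LogCorr, §1.3 with Theorem 1.1] -/
theorem BBS2015_cesaro_corrected_of_barrier (h : WeaklySAWFourDimLogCorrections) :
    BBS2015_cesaro_corrected :=
  BBS2015_cesaro_corrected_of_thm11 h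

/-! ### Consistency of the two corrected statements: the pointwise prediction implies the Cesàro one -/

/-- **The (corrected) pointwise prediction implies the (corrected) Cesàro statement**, for one `g`:
if `0 ≤ g`, `A > 0` and `c_T e^{-ν_c T}/(A (log T)^{1/4}) → 1`, then
`∫₀ᵀ c_S e^{-ν_c S} dS/(T · A (log T)^{1/4}) → 1` — the elementary Abelian/Cesàro direction for the
non-decreasing slowly varying comparison function `(log ·)^{1/4}`
(`Literature.Analysis.Asymptotics.tendsto_setIntegral_div_of_tendsto_div`); `c_T ≤ 1` makes
`t ↦ c_t e^{-ν_c t}` locally integrable. This is the sense in which the paper's "It is believed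
that [the Cesàro statement] remains true without Cesàro average" is a strengthening.
[cite: BauerschmidtBrydgesSlade2015LogCorr, §1.3 (pointwise versus Cesàro asymptotics of c_T)] -/
theorem tendsto_cesaro_of_tendsto_pointwise {g A : ℝ} (hg : 0 ≤ g) (hA : 0 < A)
    (h : Tendsto (fun T : ℝ =>
        (survival 4 g T).toReal * Real.exp (-criticalNu 4 g * T) / (A * Real.log T ^ (1 / 4 : ℝ)))
      atTop (𝓝 1)) :
    Tendsto (fun T : ℝ =>
        (∫⁻ S in Set.Ioc 0 T,
            survival 4 g S * ENNReal.ofReal (Real.exp (-criticalNu 4 g * S))).toReal /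
          (T * (A * Real.log T ^ (1 / 4 : ℝ))))
      atTop (𝓝 1) := by
  set νc := criticalNu 4 g with hνc
  set f : ℝ → ℝ := fun t => (survival 4 g t).toReal * Real.exp (-νc * t) with hf
  set L : ℝ → ℝ := fun x => Real.log x ^ (1 / 4 : ℝ) with hL
  -- hypotheses of the Abelian lemma
  have hLsv : IsSlowlyVarying L := isSlowlyVarying_log_rpow _
  have hmono : MonotoneOn L (Set.Ici 1) := by
    intro x hx y _ hxy
    simp only [hL]
    have hx0 : 0 < x := by linarith [Set.mem_Ici.mp hx]
    exact Real.rpow_le_rpow (Real.log_nonneg hx) (Real.log_le_log hx0 hxy) (by norm_num)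
  have hLpos : ∀ᶠ x in atTop, 0 < L x := by
    filter_upwards [eventually_gt_atTop 1] with x hx
    exact Real.rpow_pos_of_pos (Real.log_pos hx) _
  have hfmeas : Measurable f :=
    (measurable_survival 4 g).ennreal_toReal.mul (measurable_const.mul measurable_id).exp
  have hfint : ∀ T : ℝ, IntegrableOn f (Set.Ioc 0 T) := by
    intro T
    refine Measure.integrableOn_of_bounded measure_Ioc_lt_top.ne hfmeas.aestronglyMeasurable
      (M := Real.exp (|νc| * |T|)) ?_
    rw [ae_restrict_iff' measurableSet_Ioc]
    refine ae_of_all _ fun t ht => ?_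
    have hc : (survival 4 g t).toReal ≤ 1 := by
      have := ENNReal.toReal_mono ENNReal.one_ne_top (survival_le_one hg 4 ht.1)
      simpa using this
    rw [Real.norm_eq_abs, hf]
    simp only
    rw [abs_mul, abs_of_nonneg ENNReal.toReal_nonneg, Real.abs_exp]
    calc (survival 4 g t).toReal * Real.exp (-νc * t) ≤ 1 * Real.exp (|νc| * |T|) := by
          refine mul_le_mul hc (Real.exp_le_exp.mpr ?_) (Real.exp_pos _).le zero_le_one
          calc -νc * t ≤ |-νc * t| := le_abs_self _
            _ = |νc| * |t| := by rw [abs_mul, abs_neg]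
            _ ≤ |νc| * |T| := by
                refine mul_le_mul_of_nonneg_left ?_ (abs_nonneg _)
                rw [abs_of_pos ht.1]
                exact ht.2.trans (le_abs_self T)
      _ = Real.exp (|νc| * |T|) := one_mul _
  have hfL : Tendsto (fun t => f t / L t) atTop (𝓝 A) := by
    have h2 := h.const_mul A
    rw [mul_one] at h2
    refine h2.congr' ?_
    filter_upwards [eventually_gt_atTop 1] with t ht
    have hLt : L t ≠ 0 := (Real.rpow_pos_of_pos (Real.log_pos ht) _).ne'
    simp only [hf, hL] at hLt ⊢
    field_simp
  -- the Abelian lemma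
  have hK := tendsto_setIntegral_div_of_tendsto_div hLsv hmono hLpos hfint hfL
  -- back to the `ℝ≥0∞` integral of the statement
  have hconv : ∀ T : ℝ, ∫ t in Set.Ioc 0 T, f t =
      (∫⁻ S in Set.Ioc 0 T, survival 4 g S * ENNReal.ofReal (Real.exp (-νc * S))).toReal := by
    intro T
    have hmeas : AEMeasurable (fun S => survival 4 g S * ENNReal.ofReal (Real.exp (-νc * S)))
        (volume.restrict (Set.Ioc 0 T)) :=
      ((measurable_survival 4 g).mul
        ((measurable_const.mul measurable_id).exp.ennreal_ofReal)).aemeasurable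
    have hae : ∀ᵐ S ∂(volume.restrict (Set.Ioc 0 T)),
        survival 4 g S * ENNReal.ofReal (Real.exp (-νc * S)) < ∞ := by
      rw [ae_restrict_iff' measurableSet_Ioc]
      refine ae_of_all _ fun S hS => ENNReal.mul_lt_top ?_ ENNReal.ofReal_lt_top
      exact (survival_le_one hg 4 hS.1).trans_lt ENNReal.one_lt_top
    rw [← integral_toReal hmeas hae]
    refine integral_congr_ae (ae_of_all _ fun t => ?_)
    simp only [hf, ENNReal.toReal_mul, ENNReal.toReal_ofReal (Real.exp_pos _).le]
  have h3 := hK.div_const A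
  rw [div_self hA.ne'] at h3
  refine h3.congr' ?_
  filter_upwards [eventually_gt_atTop 0] with T hT
  rw [hconv T]
  simp only [hL]
  rw [div_div]
  congr 1
  ring

/-- **`BBS2015_pointwise_prediction_corrected → BBS2015_cesaro_corrected`**: the two sign-corrected
readings of §1.3 are consistent — the believed pointwise asymptotics imply the proved Cesàro
asymptotics (same `g₀`, same `A`). [cite: BauerschmidtBrydgesSlade2015LogCorr, §1.3] -/
theorem BBS2015_cesaro_corrected_of_pointwise (h : BBS2015_pointwise_prediction_corrected) :
    BBS2015_cesaro_corrected := by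
  obtain ⟨g₀, hg₀, hg⟩ := h
  refine ⟨g₀, hg₀, fun g hg0 hgg => ?_⟩
  obtain ⟨A, hA, hT⟩ := hg g hg0 hgg
  exact ⟨A, hA, tendsto_cesaro_of_tendsto_pointwise hg0.le hA hT⟩

end CTWSAW

end Literature.Barriers.CriticalPhenomena
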